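import Summits.AtomisticToContinuum.HydrodynamicLimit.Theorems.MourreKoopmanChargesLinearToEntropyInBandDefsB
import HarnessLib

/-!
# Route `MourreKoopmanCharges` — posited objects of the crux line for `LinearToEntropyInBand`, part C

§ 4 of the objects module of the crux `MourreKoopmanCharges.LinearToEntropyInBand`
(stmt-AtomisticToContinuum-17740, line `registered`), skeleton v8 (lead prover-line-…-17740-c5-0, wave 3 of
2026-08-17).  Parts A (`…Defs`, p146669) and B (`…DefsB`, p161297) are imported, never modified.  New here:

* (g) `DenseKineticContentW η` / `DenseKineticContentInBand` — the per-time, kinetic-energy-weighted `L¹` content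
  of the MESOSCOPICALLY DENSE particles (the dense indicator of `InvisibleCollisionThroughputW` /
  `MesoscopicBlockLD` (ii): `R`-cone density above `(5/4) ρ_s(xᵢ)`) vanishes along guarded classical solutions under
  the TRUE law.  It is the sixth antecedent of the corrected stub 4a-ii of skeleton v8 (the wave-3 audit of the
  registered v7 stub, `Cruxes/LinearToEntropyInBand/…` report of the 4a-ii worker: the suprathermal CUBIC streaming
  content of the slow-but-dense particles that the visible functional `visCoreN` drops, and the energy-direction cross
  terms of the block Euler remainder, are priced by the entropy inequality only at a rate `≲ 1/(2θK)` — a Grönwall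
  coefficient growing with the visibility cut `K`, which `WindowClauseInBand` fixes before `ε`; `EnergyCurrentTailsBelow`
  sees only speeds above `M(ε)`, the coherence input only time-coherent particles, the collision inputs are
  collision-weighted; with the `(1 + ‖v‖²)`-weighted dense content SMALL per time both become `ε`-terms, since
  `Σ_dense ‖W‖³ 𝟙{‖W‖ ≤ K} ≤ K Σ_dense (1 + ‖W‖²)` and `R₀` may depend on `K`).  A bare true-law input of the same
  grade as the dense half of `InvisibleCollisionThroughputW` ("no mesoscopic clustering before the shock", kinetic
  form); skeleton v8 registers the two together as ONE stub `stub_noMesoscopicClusteringInBand`.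
* (h) the registered bookkeeping stub `stub_objectsV8` (antitonicity of (g); sorry-free).

Lean conventions (documented junk): as in parts A/B — `Φ.flow` junk off the Liouville-conull good set is invisible under
`localGibbsLaw`; the guard makes the statement vacuous along solutions leaving the band.  Nothing here restates the
crux, the route's items or the Statement; (g) is a posited OPEN input, never asserted.  References: Yau1991 §2,
OllaVaradhanYau1993 §3–4 (large-velocity cut-off), Spohn1991 Part I §3.3.
-/

noncomputable section

open MeasureTheory Filter Set
open scoped ENNReal Topology InnerProductSpace BigOperators

namespace Summit.AtomisticToContinuum.HydrodynamicLimit.Theorems.LTEInBand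

open Literature.MathematicalPhysics.KineticTheory Literature.Analysis.FluidPDE Literature.Analysis.FunctionSpaces

/-! ## § 4 Objects of skeleton v8 -/

/-! ### (g) Per-time kinetic content of the mesoscopically dense particles -/

/-- **Per-time energy-weighted content of the mesoscopically DENSE particles vanishes, below packing level `η`**
(sixth antecedent of the corrected stub 4a-ii of skeleton v8; frame of `EnergyCurrentTailsBelow η`, dense indicator
of `InvisibleCollisionThroughputW η` / `MesoscopicBlockLD` (ii), time-POINTWISE with `∀ s ∈ [0,t]` innermost, weight
`1 + ‖v‖²`): along every guarded classical solution and flow family with local Gibbs data converging at `t = 0`,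
`∀ t < T ∀ η' > 0 ∃ R₀ > 0 ∀ R ≥ R₀ ∃ N₀ ∀ N ≥ N₀ ∀ s ∈ [0,t]`,
`E_P[(N+1)⁻¹ Σᵢ 𝟙{(5/4) ρ_s(xᵢ(s)) < (N+1)⁻¹ Σⱼ cone R N xᵢ(s) xⱼ(s)} (1 + ‖vᵢ(s)‖²)] ≤ η'`.
"No mesoscopic clustering before the shock" in kinetic-energy-weighted `L¹` — an LLN-type statement at the
mesoscopic scale `R (N+1)^{-1/3}` under the TRUE law (implied by entropy `o(N)` + `MesoscopicBlockLD` (ii), hence of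
conclusion strength as an input; 13734-type, like the dense half of `InvisibleCollisionThroughputW`).  Junk: `Φ.flow`
off the good set (invisible under `localGibbsLaw`). -/
def DenseKineticContentW (η : ℝ) : Prop :=
  ∀ (a₀ θ₀ : T3 → ℝ) (u₀ : T3 → V3), Continuous a₀ → Continuous θ₀ → Continuous u₀ → (∀ x, 0 < a₀ x) →
    (∀ x, 0 < θ₀ x) → ∃ σ₀ : ℝ, 0 < σ₀ ∧ ∀ σ : ℝ, 0 < σ → σ < σ₀ →
    ∀ (T : ℝ) (ρ θ : ℝ → T3 → ℝ) (u : ℝ → T3 → V3), IsHardSphereEulerSolution σ T ρ u θ →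
    (∀ t ∈ Set.Ico 0 T, ∀ x, ρ t x * σ ^ 3 < η) →
    ∀ Φ : (N : ℕ) → HardSphereFlow (Torus.geometry (Fin 3)) (hsDiameter σ N) (N + 1),
    TendstoHydroFieldsAt (fun N => localGibbsLaw σ a₀ u₀ θ₀ N (Φ N)) Φ ρ u θ 0 →
    ∀ t ∈ Set.Ico 0 T, ∀ η' : ℝ, 0 < η' → ∃ R₀ : ℝ, 0 < R₀ ∧ ∀ R : ℝ, R₀ ≤ R → ∃ N₀ : ℕ, ∀ N : ℕ, N₀ ≤ N →
    ∀ s ∈ Set.Icc 0 t,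
      ∫⁻ z, ENNReal.ofReal (((N : ℝ) + 1)⁻¹ * ∑ i : Fin (N + 1),
        (if 5 / 4 * ρ s ((Φ N).flow s z i).1 <
            ((N : ℝ) + 1)⁻¹ * ∑ j : Fin (N + 1), cone R N ((Φ N).flow s z i).1 ((Φ N).flow s z j).1
          then 1 + ‖((Φ N).flow s z i).2‖ ^ 2 else 0)) ∂(localGibbsLaw σ a₀ u₀ θ₀ N (Φ N)) ≤ ENNReal.ofReal η'

/-- `DenseKineticContentW η` for SOME packing level `η > 0`. -/
def DenseKineticContentInBand : Prop :=
  ∃ η : ℝ, 0 < η ∧ DenseKineticContentW η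

/-- The guard is monotone in the packing level, so the per-time dense kinetic content is ANTITONE in `η`
(same two-line proof as every guarded input of parts A/B). -/
theorem denseKineticContentW_antitone {η η' : ℝ} (hle : η' ≤ η) :
    DenseKineticContentW η → DenseKineticContentW η' := by
  intro H a₀ θ₀ u₀ ha hθ hu hap hθp
  obtain ⟨σ₀, hσ₀, G⟩ := H a₀ θ₀ u₀ ha hθ hu hap hθp
  exact ⟨σ₀, hσ₀, fun σ hσ hσ' T ρ θ u hE hguard =>
    G σ hσ hσ' T ρ θ u hE fun t ht x => (hguard t ht x).trans_le hle⟩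

/-- **(h) Registered bookkeeping stub `stub_objectsV8` of skeleton v8**: antitonicity of (g) in the packing level,
in the fully applied form the composition `stub_windowClauseVisibleInBandOfPieces` (S5 of v8) consumes.  Sorry-free. -/
theorem stub_objectsV8 : ∀ η η' : ℝ, η' ≤ η → Summit.AtomisticToContinuum.HydrodynamicLimit.Theorems.LTEInBand.DenseKineticContentW η → Summit.AtomisticToContinuum.HydrodynamicLimit.Theorems.LTEInBand.DenseKineticContentW η' :=
  fun _ _ h => denseKineticContentW_antitone h

end Summit.AtomisticToContinuum.HydrodynamicLimit.Theorems.LTEInBand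

end
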